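import Literature.AlgebraicGeometry.HodgeTheory.AlgebraicClassesCupDivisorHolds
import Literature.AlgebraicGeometry.HodgeTheory.HardLefschetzNFoldOfPolarizationClass
import HarnessLib

/-!
# The Hodge conjecture for `X` implies Grothendieck's standard conjecture `A(X, η)` for every polarisation class `η` (real carriers)

Family `hodge`, layer `Literature/AlgebraicGeometry/HodgeTheory`. Grothendieck's standard conjecture
of Lefschetz type in the form `A(X)` (A. Grothendieck, *Standard conjectures on algebraic cycles*,
Bombay 1968, §3 p. 196; on the tree's real carriers `StandardConjectureA n X η`, file
`MotivatedClasses`: (a) hard Lefschetz for `η` in dimension `n`, and (b) for `2p + r = n`, `p + r = q`,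
`Lʳ = (η ∪ ·)ʳ` maps `Nᵖ H²ᵖ(X(ℂ); ℂ) = algebraicClasses X p` BIJECTIVELY onto
`N^q H^{2p+2r}(X(ℂ); ℂ)`) follows from the Hodge conjecture for `X` ITSELF — the standard remark that
under `HC(X)` the algebraic classes are exactly the (complexified) Hodge classes, on which
`Lʳ : Hdg^p(X) ⊗ ℂ → Hdg^{n−p}(X) ⊗ ℂ` is an isomorphism by the hard Lefschetz theorem (C. Voisin, *Hodge
Theory and Complex Algebraic Geometry I*, Thm. 6.25, with Rem. 6.27 / §7.1.2: `Lʳ` is defined over `ℚ`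
and of bidegree `(r, r)`, so it maps rational `(p,p)`-classes onto rational `(n−p, n−p)`-classes). The
summit-side companion is the named fact `Kleiman1968_lefschetzInvolution_algebraic_of_hodgeClasses_prod`
(`LefschetzStandardConjectureFacts`: `HC(X × X) ⇒ B(X)`), which this file does not touch.

On the tree's carriers the remark needs three recent theorems: every polarisation class carries the
hard Lefschetz datum `HardLefschetzNFold` (its inputs: the divisor case of Voisin II Prop. 9.20,
`lefschetzOperator_mem_algebraicClasses_of_mem` / `lefschetzPow_mem_supportedClasses_of_mem`, file
`AlgebraicClassesCupDivisorHolds`, and "`L` is of bidegree `(1,1)`", from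
`isOfHodgeType_of_mem_algebraicClasses_of_isSmoothProjective` and
`cupPreservesHodgeType_of_multiplicative_deRham`), the rational spanning of the coniveau spaces
(`supportedClasses_le_span_isRationalClass`), and the Hodge type of algebraic classes. Proved here:

* `lefschetzPow_mapsTo_algebraicClasses` — (b), "into": `Lʳ(Nᵖ H²ᵖ) ⊆ N^{p+r} H^{2p+2r}` for every
  `η ∈ N¹ H²`, unconditionally (no Hodge conjecture);
* `lefschetzPow_surjOn_algebraicClasses_of_hodgeClasses_algebraic` — (b), "onto", GRANTED that the
  rational `(p,p)`-classes of `X` of codimension `p` are algebraic (`2p + r = n`);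
* `standardConjectureA_of_hodgeClasses_algebraic`, `standardConjectureA_of_hodgeConjectureFor` —
  **`HC(X)` (in codimension `p ≤ n/2`, resp. `HodgeConjectureFor n X`) ⇒ `A(X, η)` for every
  polarisation class `η`**; `standardConjectureA_of_dim_le_three` — hence `A(X, η)` unconditionally
  for curves, surfaces and threefolds (`hodgeConjectureFor_of_dim_le_three_holds`).

Theorems only; no definition, no named fact (D-0026).

## References

* [Grothendieck1968] A. Grothendieck, Standard conjectures on algebraic cycles (Bombay 1968), §3
  p. 196 (`A(X)`, `B(X)`; "`B(X) ⇒ A(X)`").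
* [VoisinHodgeI2002] C. Voisin, Hodge Theory and Complex Algebraic Geometry I (CUP 2002), Thm. 6.25,
  Rem. 6.27, §7.1.2, Thm. 11.30.
* [Andre1996Motifs] Y. André, Publ. Math. IHÉS 83 (1996), §1.1 (p. 10) (polarisations, hard Lefschetz).
-/

noncomputable section

open CategoryTheory
open Literature.AlgebraicTopology.SingularHomology Literature.Geometry.Kaehler

namespace Literature.AlgebraicGeometry.HodgeTheory

section HodgeTheory

variable {n : ℕ} {X : Motives.SchemeOver ℂ} {η : complexBetti X 2}

/-- **(b), "into", unconditionally**: for `X` smooth projective over `ℂ`, `η ∈ N¹ H²(X(ℂ); ℂ)` and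
`p + r = q`, `Lʳ = (η ∪ ·)ʳ` maps `Nᵖ H²ᵖ` into `N^q H^{2p+2r}` (iterate the divisor case of Voisin II
Prop. 9.20, `lefschetzPow_mem_supportedClasses_of_mem`). [cite: VoisinHodgeII2003, §9.2.4 Prop. 9.20]
[cite: Grothendieck1968, §3 p. 196 (A(X))] -/
theorem lefschetzPow_mapsTo_algebraicClasses (hX : Motives.IsSmoothProjective n X)
    (hη : η ∈ algebraicClasses X 1) {p r q : ℕ} (hq : p + r = q) :
    Set.MapsTo (lefschetzPow η r (2 * p)) (algebraicClasses X p : Set (complexBetti X (2 * p)))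
      (supportedClasses X (2 * p + 2 * r) q) := by
  subst hq
  exact fun x hx ↦ lefschetzPow_mem_supportedClasses_of_mem hX hη p hx r

/-- **(b), "onto", from the Hodge conjecture for `X` in codimension `p`**: let `X` be smooth projective
of dimension `n` over `ℂ`, `η` a polarisation class, `2p + r = n` and `p + r = q`; if every rational
`(p,p)`-class in `H²ᵖ(X(ℂ); ℂ)` is algebraic, then every class of `N^q H^{2p+2r}(X(ℂ); ℂ)` is `Lʳ` of an
algebraic class of codimension `p`. Proof: `N^q` is the complex span of its rational classes
(`supportedClasses_le_span_isRationalClass`), which are algebraic hence of type `(q, q)`; by hard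
Lefschetz over `ℚ` and the bidegree of `Lʳ` (the datum `HardLefschetzNFold` of `η`,
`exists_hardLefschetzNFold_of_isPolarizationClass` with its two inputs now theorems) each is `Lʳ x` with
`x` rational of type `(p, p)` (`HardLefschetzNFold.exists_hdg_preimage`), algebraic by hypothesis; and
`Lʳ` is linear. [cite: VoisinHodgeI2002, Thm. 6.25, Rem. 6.27 and §7.1.2]
[cite: Grothendieck1968, §3 p. 196 (A(X))] -/
theorem lefschetzPow_surjOn_algebraicClasses_of_hodgeClasses_algebraic
    (hX : Motives.IsSmoothProjective n X) (hη : IsPolarizationClass n X η) {p r q : ℕ}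
    (hpr : 2 * p + r = n) (hq : p + r = q)
    (hHC : ∀ c : complexBetti X (2 * p), IsRationalClass c → IsOfHodgeType n X (2 * p) p p c →
      c ∈ algebraicClasses X p) :
    Set.SurjOn (lefschetzPow η r (2 * p)) (algebraicClasses X p : Set (complexBetti X (2 * p)))
      (supportedClasses X (2 * p + 2 * r) q) := by
  subst hq
  -- the hard Lefschetz datum of `η`
  obtain ⟨Λ, hΛ⟩ := exists_hardLefschetzNFold_of_isPolarizationClass hX hη
    (fun l _ hc ↦ lefschetzOperator_mem_algebraicClasses_of_mem hX hη.mem_algebraicClasses l hc)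
    (isOfHodgeType_lefschetzOperator_of_cupPreservesHodgeType
      (cupPreservesHodgeType_of_multiplicative_deRham
        (fun E _ _ _ ↦ Literature.NumberTheory.Transcendental.exists_deRhamIsoFamily_holds E) hX)
      (isOfHodgeType_of_mem_algebraicClasses_of_isSmoothProjective hX 1 hη.mem_algebraicClasses))
  subst hΛ
  -- algebraic classes of degree `2p + 2r` are of type `(p + r, p + r)` (degree spelling transported)
  have hT : ∀ {i : ℕ} (_ : i = 2 * (p + r)) (y : complexBetti X i),
      y ∈ supportedClasses X i (p + r) → IsOfHodgeType n X i (p + r) (p + r) y := by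
    intro i hi y hy
    subst hi
    exact isOfHodgeType_of_mem_algebraicClasses_of_isSmoothProjective hX (p + r) hy
  -- it suffices to hit the rational classes of `N^{p+r}`, the target of a linear map being a subspace
  intro y hy
  have hle : supportedClasses X (2 * p + 2 * r) (p + r) ≤
      (algebraicClasses X p).map (lefschetzPow Λ.hyperplaneClass r (2 * p)) := by
    refine (supportedClasses_le_span_isRationalClass hX _ _).trans (Submodule.span_le.2 ?_)
    rintro y ⟨hyQ, hyS⟩
    obtain ⟨x, hxQ, hxT, hxy⟩ := Λ.exists_hdg_preimage (j := r) (k := 2 * p) hpr (2 * p + 2 * r) rfl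
      p p y hyQ (hT (by omega) y hyS)
    exact ⟨x, hHC x hxQ hxT, hxy⟩
  obtain ⟨x, hx, rfl⟩ := Submodule.mem_map.1 (hle hy)
  exact ⟨x, hx, rfl⟩

/-- **The Hodge conjecture for `X` in codimensions `p ≤ n/2` implies `A(X, η)` for every polarisation
class `η`** (Grothendieck 1968 §3, on the real carriers; the standard remark: under `HC(X)` algebraic
classes = complexified Hodge classes, on which `Lⁿ⁻²ᵖ` is an isomorphism by hard Lefschetz over `ℚ` of
bidegree `(n−2p, n−2p)`, Voisin I Thm. 6.25 / Rem. 6.27 / §7.1.2): clause (a) is the hard Lefschetz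
property of the polarisation class; clause (b) is `lefschetzPow_mapsTo_algebraicClasses` (into,
unconditional), the injectivity of `Lʳ` on all of `H²ᵖ` (hard Lefschetz), and
`lefschetzPow_surjOn_algebraicClasses_of_hodgeClasses_algebraic` (onto, from the hypothesis).
[cite: Grothendieck1968, §3 p. 196 (A(X))] [cite: VoisinHodgeI2002, Thm. 6.25, Rem. 6.27 and §7.1.2] -/
theorem standardConjectureA_of_hodgeClasses_algebraic (hX : Motives.IsSmoothProjective n X)
    (hη : IsPolarizationClass n X η)
    (hHC : ∀ p : ℕ, 2 * p ≤ n → ∀ c : complexBetti X (2 * p), IsRationalClass c →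
      IsOfHodgeType n X (2 * p) p p c → c ∈ algebraicClasses X p) :
    StandardConjectureA n X η := by
  refine ⟨hη.hasHardLefschetz, fun p r q hpr hq ↦ ⟨?_, ?_, ?_⟩⟩
  · exact lefschetzPow_mapsTo_algebraicClasses hX hη.mem_algebraicClasses hq
  · exact (hη.hasHardLefschetz r (2 * p) hpr).1.injOn
  · exact lefschetzPow_surjOn_algebraicClasses_of_hodgeClasses_algebraic hX hη hpr hq
      (hHC p (by omega))

/-- **`HodgeConjectureFor n X` implies `A(X, η)` for every polarisation class `η`.**
[cite: Grothendieck1968, §3 p. 196 (A(X))] [cite: VoisinHodgeI2002, Thm. 6.25 and §7.1.2] -/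
theorem standardConjectureA_of_hodgeConjectureFor (hX : Motives.IsSmoothProjective n X)
    (hη : IsPolarizationClass n X η) (h : HodgeConjectureFor n X) : StandardConjectureA n X η :=
  standardConjectureA_of_hodgeClasses_algebraic hX hη fun p _ c hc hpp ↦ h.2 p c hc hpp

/-- **`A(X, η)` holds unconditionally for curves, surfaces and threefolds**, every polarisation class
`η` (the Hodge conjecture being a theorem of the tree in dimension `≤ 3`,
`hodgeConjectureFor_of_dim_le_three_holds`). [cite: Grothendieck1968, §3 p. 196 (A(X))]
[cite: VoisinHodgeII2003, §10.2.3 proof of Prop. 10.26] -/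
theorem standardConjectureA_of_dim_le_three (hn : n ≤ 3) (hX : Motives.IsSmoothProjective n X)
    (hη : IsPolarizationClass n X η) : StandardConjectureA n X η :=
  standardConjectureA_of_hodgeConjectureFor hX hη (hodgeConjectureFor_of_dim_le_three_holds hn hX)

end HodgeTheory

end Literature.AlgebraicGeometry.HodgeTheory

end
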